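import Mathlib
import Literature.Computability.MetaComplexity.GaussianWidth
import Summits.PneNP.PneNP.Theorems.PstarPDT
import Summits.PneNP.PneNP.Theorems.PstarFibrePolys

/-!
# The trivial parity-decision-tree upper bound for pure `P⋆` fibres (ROUND-24 pre-seed, item T24.2)

FRONTIER range-avoidance ladder, rung F-N3 (cell `pnp-ideate`; memo `HOME/pnp-ideate-p3/r24/ROUND-24-PRESEED.md` §6(4);
restricted-model proof complexity — nothing here bears on `P` vs `NP`).

`PstarPDT` fixed the model: parity decision trees `PDT n m` for the falsified-output search problem `Search(I, y)` of a local
map `I : LocalMap k n m` and a target `y`, with `exists_solves_of_not_mem_range` (depth `n` always suffices).  This file proves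
the CALIBRATING upper bound announced there for pure `P⋆ = u₀ ⊕ u₁ ⊕ u₂u₃` instances:

* `exists_solves_depth_le` — if `I` is pure `P⋆` and `y ∉ Range(I)` then some PDT solves `Search(I, y)` in depth
  `≤ #(andVars I) + ⌈log₂ m⌉`, where `andVars I = ⋃_j {vars j 2, vars j 3}` is the set of AND-read input positions.

So for the boundary-expanding TYPED families of R21–R23 (AND layer `A`, `|A| = Θ(n)`) the least solving depth is `≤ |A| + O(log m)`,
and any `Ω(n)` lower bound (the held R24 statements) must charge the AND layer; on instances whose AND layer is small the search
problem is PDT-easy although Sherali–Adams of linear level is blind (the Grigoriev caveat in PDT language).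

## The engine (no `Typed` hypothesis is needed)

Query every AND-read position singly (`exists_pdt_query_vars`: pin a set `A`, then continue — depth `#A + d`).  On the branch with
answers `ρ` the constraint of output `j = (u, v, p, q)` LINEARISES to the affine `𝔽₂` test `z_u + z_v = y_j + ρ_p ρ_q` (`linTest`),
which is sound on the branch: a non-zero discrepancy means output `j` is violated (`eval_ne_of_disc_ne_zero`).  The pinned system
`{z_u + z_v = y_j + ρ_p ρ_q}_j ∪ {z_v = ρ_v}_{v ∈ A}` on ALL `n` unknowns is infeasible (a solution is a Boolean preimage of `y`,
`not_systemSat_pinned`), so the tree's Fredholm alternative over `𝔽₂` (`GaussianWidth.exists_lincomb_eq_zero_one`) yields rows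
`R ⊆ [m]`, `A′ ⊆ A` with `Σ_R (e_u + e_v) = Σ_{A′} e_v` and `Σ_R (y_j + ρ_p ρ_q) + Σ_{A′} ρ_v = 1`; evaluating at any `z` on the
branch, THE TOTAL DISCREPANCY OF `R` IS ODD (`exists_odd_rows`).  Binary search (`exists_pdt_binary_search`, stated for abstract affine
tests and an abstract leaf predicate `good`): split `R = R₁ ⊔ R₂` into halves, query the parity `supp (Σ_{R₁} (e_u + e_v))`, which
reveals the discrepancy of `R₁`; recurse into the half whose discrepancy is odd; after `⌈log₂ #R⌉ ≤ ⌈log₂ m⌉` queries one output of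
odd — i.e. non-zero — discrepancy remains, and it is violated.
-/

set_option linter.dupNamespace false

open Finset Literature.Computability.Complexity Literature.Computability.MetaComplexity
open Summit.PneNP.PneNP.Theorems.PstarFibrePolys (bit bit_xor bit_and bit_injective)

namespace Summit.PneNP.PneNP.Theorems.PstarPDT

variable {k n m : ℕ}

/-! ## Affine `𝔽₂` tests on Boolean inputs -/

/-- Every element of `𝔽₂` is `0` or `1`. -/
private theorem zmod2_eq_zero_or_one (a : ZMod 2) : a = 0 ∨ a = 1 := by
  revert a; decide

/-- `x + x = 0` in `𝔽₂`. -/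
private theorem zmod2_add_self (a : ZMod 2) : a + a = 0 := by
  revert a; decide

/-- The linear part `Σ_v E.1 v · z_v` of the equation `E` at the Boolean input `z`. -/
def linVal (E : LinEqMod 2 n) (z : Fin n → Bool) : ZMod 2 := ∑ v, E.1 v * bit (z v)

/-- The DISCREPANCY `Σ_v E.1 v · z_v + E.2` of the affine test `E` at `z` (zero iff `E` holds at `z`). -/
def disc (E : LinEqMod 2 n) (z : Fin n → Bool) : ZMod 2 := linVal E z + E.2

/-- The linear part counts, mod 2, the true inputs in the support. -/
theorem linVal_eq_card (E : LinEqMod 2 n) (z : Fin n → Bool) :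
    linVal E z = ((E.supp.filter fun v => z v = true).card : ZMod 2) := by
  unfold linVal
  have key : ∀ v ∈ (univ : Finset (Fin n)),
      E.1 v * bit (z v) = if v ∈ E.supp.filter (fun v => z v = true) then 1 else 0 := by
    intro v _
    simp only [mem_filter, LinEqMod.mem_supp]
    rcases zmod2_eq_zero_or_one (E.1 v) with h | h
    · simp [h]
    · cases z v <;> simp [h, bit]
  rw [sum_congr rfl key, sum_boole, filter_univ_mem]

/-- A parity query on the support of `E` returns `true` iff the linear part of `E` is `1`. -/
theorem parity_supp_eq_true_iff (E : LinEqMod 2 n) (z : Fin n → Bool) :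
    parity E.supp z = true ↔ linVal E z = 1 := by
  simp only [parity, decide_eq_true_eq, linVal_eq_card, ZMod.natCast_eq_one_iff_odd]

/-- The answer `b` to the parity query on `supp E` determines the linear part: `Σ_v E.1 v z_v = b`. -/
theorem linVal_of_parity {E : LinEqMod 2 n} {z : Fin n → Bool} {b : Bool} (h : parity E.supp z = b) :
    linVal E z = bit b := by
  cases b
  · rcases zmod2_eq_zero_or_one (linVal E z) with h0 | h1
    · simpa [bit] using h0
    · exact absurd ((parity_supp_eq_true_iff E z).2 h1) (by rw [h]; decide)
  · simpa [bit] using (parity_supp_eq_true_iff E z).1 h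

/-- The discrepancies of a row set add up to the discrepancy of its row sum. -/
theorem sum_disc_eq (E : Fin m → LinEqMod 2 n) (R : Finset (Fin m)) (z : Fin n → Bool) :
    ∑ j ∈ R, disc (E j) z = linVal (rowComb E R) z + (rowComb E R).2 := by
  simp only [disc, sum_add_distrib]
  congr 1
  · simp only [linVal, rowComb_fst_apply, sum_mul]
    rw [sum_comm]
  · simp only [rowComb, lincomb, ite_mul, one_mul, zero_mul, sum_ite_mem, univ_inter]

/-! ## Two generic tree constructions -/

/-- **Binary search along an odd row set.**  Let `E_j` be an affine `𝔽₂` test attached to each output `j`, SOUND on the inputs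
satisfying `W` (a non-zero discrepancy of `E_j` certifies that leaf `j` is `good`).  If the total discrepancy of a non-empty row
set `R` with `#R ≤ 2^d` is `1` on every input satisfying `W`, then a PDT of depth `≤ d` reaches a good leaf on all of `W`. -/
theorem exists_pdt_binary_search (good : (Fin n → Bool) → Fin m → Prop) (E : Fin m → LinEqMod 2 n) :
    ∀ (d : ℕ) (R : Finset (Fin m)) (W : (Fin n → Bool) → Prop),
      (∀ z, W z → ∀ j ∈ R, disc (E j) z ≠ 0 → good z j) → R.Nonempty → R.card ≤ 2 ^ d →
      (∀ z, W z → ∑ j ∈ R, disc (E j) z = 1) →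
      ∃ T : PDT n m, T.depth ≤ d ∧ ∀ z, W z → good z (T.run z) := by
  intro d
  induction d with
  | zero =>
    intro R W hsound hne hcard hodd
    obtain ⟨j, rfl⟩ : ∃ j, R = {j} := card_eq_one.1 (le_antisymm (by simpa using hcard) hne.card_pos)
    refine ⟨PDT.leaf j, le_rfl, fun z hz => hsound z hz j (mem_singleton_self j) ?_⟩
    have h1 := hodd z hz
    rw [sum_singleton] at h1
    rw [h1]
    exact one_ne_zero
  | succ d ih =>
    intro R W hsound hne hcard hodd
    by_cases hsmall : R.card ≤ 2 ^ d
    · obtain ⟨T, hT, hgood⟩ := ih R W hsound hne hsmall hodd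
      exact ⟨T, by omega, hgood⟩
    obtain ⟨R₁, hR₁R, hR₁card⟩ := exists_subset_card_eq (show 2 ^ d ≤ R.card by omega)
    have hpos : 0 < 2 ^ d := Nat.two_pow_pos d
    have hR₂card : (R \ R₁).card ≤ 2 ^ d := by
      rw [card_sdiff_of_subset hR₁R, pow_succ] at *
      omega
    have hR₁ne : R₁.Nonempty := by rw [← card_pos, hR₁card]; exact hpos
    have hR₂ne : (R \ R₁).Nonempty := by rw [← card_pos, card_sdiff_of_subset hR₁R]; omega
    have hsplit : ∀ z, ∑ j ∈ R, disc (E j) z = ∑ j ∈ R₁, disc (E j) z + ∑ j ∈ R \ R₁, disc (E j) z := by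
      intro z
      rw [← sum_sdiff hR₁R, add_comm]
    -- the query: the support of the row sum of `R₁`
    set L : LinEqMod 2 n := rowComb E R₁ with hL
    have hsub : ∀ b : Bool, ∃ T : PDT n m, T.depth ≤ d ∧ ∀ z, (W z ∧ parity L.supp z = b) → good z (T.run z) := by
      intro b
      by_cases hb : bit b + L.2 = 1
      · refine ih R₁ (fun z => W z ∧ parity L.supp z = b) (fun z hz j hj => hsound z hz.1 j (hR₁R hj)) hR₁ne
          (le_of_eq hR₁card) ?_
        rintro z ⟨_, hpar⟩
        rw [sum_disc_eq, ← hL, linVal_of_parity hpar]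
        exact hb
      · refine ih (R \ R₁) (fun z => W z ∧ parity L.supp z = b) (fun z hz j hj => hsound z hz.1 j (sdiff_subset hj))
          hR₂ne hR₂card ?_
        rintro z ⟨hz, hpar⟩
        have h1 := hodd z hz
        rw [hsplit, sum_disc_eq E R₁, ← hL, linVal_of_parity hpar] at h1
        rcases zmod2_eq_zero_or_one (bit b + L.2) with h0 | h0
        · rw [h0, zero_add] at h1
          exact h1
        · exact absurd h0 hb
    obtain ⟨T₀, hT₀, hg₀⟩ := hsub false
    obtain ⟨T₁, hT₁, hg₁⟩ := hsub true
    refine ⟨PDT.node L.supp T₀ T₁, ?_, fun z hz => ?_⟩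
    · simp only [PDT.depth]
      omega
    · simp only [PDT.run]
      by_cases hpar : parity L.supp z = true
      · rw [if_pos hpar]
        exact hg₁ z ⟨hz, hpar⟩
      · rw [if_neg hpar]
        exact hg₀ z ⟨hz, Bool.eq_false_iff.mpr hpar⟩

/-- **Pin a set of positions, then continue.**  If for every assignment `ρ` some PDT of depth `≤ d` reaches a good leaf on all
inputs agreeing with `ρ` on `A`, then a PDT of depth `≤ #A + d` reaches a good leaf everywhere (query `A` singly first). -/
theorem exists_pdt_query_vars (good : (Fin n → Bool) → Fin m → Prop) (A : Finset (Fin n)) :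
    ∀ d : ℕ, (∀ ρ : Fin n → Bool, ∃ T : PDT n m, T.depth ≤ d ∧ ∀ z : Fin n → Bool, (∀ v ∈ A, z v = ρ v) → good z (T.run z)) →
      ∃ T : PDT n m, T.depth ≤ A.card + d ∧ ∀ z, good z (T.run z) := by
  induction A using Finset.induction_on with
  | empty =>
    intro d h
    obtain ⟨T, hT, hg⟩ := h fun _ => false
    exact ⟨T, by simpa using hT, fun z => hg z (by simp)⟩
  | insert v A hv ih =>
    intro d h
    have h' : ∀ ρ : Fin n → Bool, ∃ T : PDT n m, T.depth ≤ d + 1 ∧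
        ∀ z : Fin n → Bool, (∀ u ∈ A, z u = ρ u) → good z (T.run z) := by
      intro ρ
      obtain ⟨T₀, hT₀, hg₀⟩ := h (Function.update ρ v false)
      obtain ⟨T₁, hT₁, hg₁⟩ := h (Function.update ρ v true)
      refine ⟨PDT.node {v} T₀ T₁, by simp only [PDT.depth]; omega, fun z hz => ?_⟩
      have key : ∀ b : Bool, z v = b → ∀ u ∈ insert v A, z u = Function.update ρ v b u := by
        intro b hb u hu
        rcases mem_insert.1 hu with rfl | hu'
        · simp [hb]
        · have huv : u ≠ v := ne_of_mem_of_not_mem hu' hv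
          rw [Function.update_of_ne huv]
          exact hz u hu'
      simp only [PDT.run, parity_singleton]
      by_cases hzv : z v = true
      · simp only [hzv, if_true]
        exact hg₁ z (key true hzv)
      · simp only [Bool.not_eq_true] at hzv
        simp only [hzv, Bool.false_eq_true, if_false]
        exact hg₀ z (key false hzv)
    obtain ⟨T, hT, hg⟩ := ih (d + 1) h'
    exact ⟨T, by rw [card_insert_of_notMem hv]; omega, hg⟩

/-! ## The pure `P⋆` fibre: pin the AND layer, linearise, binary search -/

section Upper

variable (I : LocalMap 4 n m) (y : Fin m → Bool)

/-- The AND-read input positions of `I`: `⋃_j {vars j 2, vars j 3}`. -/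
def andVars : Finset (Fin n) := univ.biUnion fun j => ({I.vars j 2, I.vars j 3} : Finset (Fin n))

/-- The first AND slot is AND-read. -/
theorem mem_andVars_two (j : Fin m) : I.vars j 2 ∈ andVars I :=
  mem_biUnion.2 ⟨j, mem_univ _, by simp⟩

/-- The second AND slot is AND-read. -/
theorem mem_andVars_three (j : Fin m) : I.vars j 3 ∈ andVars I :=
  mem_biUnion.2 ⟨j, mem_univ _, by simp⟩

/-- At most two AND-read positions per output. -/
theorem card_andVars_le : (andVars I).card ≤ 2 * m := by
  unfold andVars
  refine (card_biUnion_le).trans ?_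
  calc ∑ j : Fin m, ({I.vars j 2, I.vars j 3} : Finset (Fin n)).card ≤ ∑ _j : Fin m, 2 :=
        sum_le_sum fun j _ => card_insert_le _ _
    _ = 2 * m := by simp [mul_comm]

/-- The LINEARISED test of output `j = (u, v, p, q)` on the branch where the AND layer answers `ρ`:
`z_u + z_v = y_j + ρ_p ρ_q` over `𝔽₂`. -/
def linTest (ρ : Fin n → Bool) (j : Fin m) : LinEqMod 2 n :=
  (fun v => (if v = I.vars j 0 then 1 else 0) + (if v = I.vars j 1 then 1 else 0),
    bit (y j) + bit (ρ (I.vars j 2)) * bit (ρ (I.vars j 3)))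

/-- The linear part of the test of output `j` at `z` is `z_u + z_v`. -/
theorem linVal_linTest (ρ z : Fin n → Bool) (j : Fin m) :
    linVal (linTest I y ρ j) z = bit (z (I.vars j 0)) + bit (z (I.vars j 1)) := by
  simp only [linVal, linTest, add_mul, sum_add_distrib, ite_mul, one_mul, zero_mul, sum_ite_eq', mem_univ, if_true]

variable {I y}

/-- Pointwise form of a pure `P⋆` output in `𝔽₂`: `I(z)_j = z_u + z_v + z_p z_q`. -/
theorem bit_eval (hI : I.IsPure xorAndPred) (z : Fin n → Bool) (j : Fin m) :
    bit (I.eval z j) = bit (z (I.vars j 0)) + bit (z (I.vars j 1)) + bit (z (I.vars j 2)) * bit (z (I.vars j 3)) := by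
  have hev : I.eval z j = xorAndPred fun s => z (I.vars j s) := by
    show I.table j _ = _
    rw [hI.1 j]
  rw [hev, xorAndPred_apply, bit_xor, bit_xor, bit_and]

/-- SOUNDNESS of the linearised test on its branch: a non-zero discrepancy means output `j` is violated. -/
theorem eval_ne_of_disc_ne_zero (hI : I.IsPure xorAndPred) (ρ z : Fin n → Bool) (hz : ∀ v ∈ andVars I, z v = ρ v)
    (j : Fin m) (h : disc (linTest I y ρ j) z ≠ 0) : I.eval z j ≠ y j := by
  intro he
  apply h
  have e1 := congrArg bit he
  rw [bit_eval hI, hz _ (mem_andVars_two I j), hz _ (mem_andVars_three I j)] at e1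
  rw [disc, linVal_linTest]
  simp only [linTest]
  linear_combination e1 + zmod2_add_self (bit (y j))

/-- The pinned system on the branch `ρ`, indexed by `Fin m ⊕ Fin n`: the `m` linearised tests and, for every AND-read position
`v`, the pin `z_v = ρ_v` (the trivial equation at the other positions). -/
def pinnedRow (ρ : Fin n → Bool) : Fin m ⊕ Fin n → LinEqMod 2 n
  | Sum.inl j => linTest I y ρ j
  | Sum.inr v => if v ∈ andVars I then (fun u => if u = v then 1 else 0, bit (ρ v)) else 0

/-- The pinned system re-indexed by `Fin (m + n)` (the shape `exists_lincomb_eq_zero_one` wants). -/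
def pinnedSys (ρ : Fin n → Bool) : Fin (m + n) → LinEqMod 2 n := fun i => pinnedRow (I := I) (y := y) ρ (finSumFinEquiv.symm i)

/-- The pinned system is infeasible over `𝔽₂` when `y ∉ Range(I)`: a solution is a Boolean preimage of `y`. -/
theorem not_systemSat_pinned (hI : I.IsPure xorAndPred) (hy : y ∉ I.range) (ρ : Fin n → Bool) :
    ¬ SystemSat (pinnedSys (I := I) (y := y) ρ) univ := by
  rintro ⟨x, hx⟩
  have hx' : ∀ i, (pinnedRow (I := I) (y := y) ρ i).Holds x := fun i => by
    simpa [pinnedSys] using hx (finSumFinEquiv i) (mem_univ _)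
  -- the solution is Boolean
  set z : Fin n → Bool := fun v => decide (x v = 1) with hzdef
  have hbz : ∀ v, bit (z v) = x v := by
    intro v
    rcases zmod2_eq_zero_or_one (x v) with h | h <;> simp [hzdef, h, bit]
  have hxz : x = fun v => bit (z v) := funext fun v => (hbz v).symm
  rw [hxz] at hx'
  have hpin : ∀ v ∈ andVars I, z v = ρ v := by
    intro v hv
    have h1 := hx' (Sum.inr v)
    simp only [pinnedRow, hv, if_true, LinEqMod.Holds, ite_mul, one_mul, zero_mul, sum_ite_eq', mem_univ] at h1
    exact bit_injective h1
  apply hy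
  refine ⟨z, funext fun j => ?_⟩
  have h1 : linVal (linTest I y ρ j) z = (linTest I y ρ j).2 := hx' (Sum.inl j)
  rw [linVal_linTest] at h1
  simp only [linTest] at h1
  apply bit_injective
  rw [bit_eval hI, hpin _ (mem_andVars_two I j), hpin _ (mem_andVars_three I j)]
  linear_combination h1 + zmod2_add_self (bit (ρ (I.vars j 2)) * bit (ρ (I.vars j 3)))

/-- **Odd row set.**  On every branch `ρ` of the AND layer there is a non-empty set `R` of outputs whose linearised tests have
total discrepancy `1` at every input of the branch (the `𝔽₂` dual certificate of the pinned system, with the pin rows evaluated). -/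
theorem exists_odd_rows (hI : I.IsPure xorAndPred) (hy : y ∉ I.range) (ρ : Fin n → Bool) :
    ∃ R : Finset (Fin m), R.Nonempty ∧
      ∀ z : Fin n → Bool, (∀ v ∈ andVars I, z v = ρ v) → ∑ j ∈ R, disc (linTest I y ρ j) z = 1 := by
  obtain ⟨c, hc⟩ := exists_lincomb_eq_zero_one _ (not_systemSat_pinned hI hy ρ)
  set c₁ : Fin m → ZMod 2 := fun j => c (finSumFinEquiv (Sum.inl j)) with hc₁
  set c₂ : Fin n → ZMod 2 := fun v => c (finSumFinEquiv (Sum.inr v)) with hc₂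
  have hsplit : ∀ f : LinEqMod 2 n → ZMod 2,
      ∑ i, c i * f (pinnedSys (I := I) (y := y) ρ i) =
        ∑ j, c₁ j * f (linTest I y ρ j) + ∑ v, c₂ v * f (pinnedRow (I := I) (y := y) ρ (Sum.inr v)) := by
    intro f
    rw [← finSumFinEquiv.sum_comp]
    simp only [Fintype.sum_sum_type, pinnedSys, Equiv.symm_apply_apply, pinnedRow, hc₁, hc₂]
  -- the two halves of the certificate
  have hfst : ∀ u, ∑ j, c₁ j * (linTest I y ρ j).1 u + ∑ v, c₂ v * (pinnedRow (I := I) (y := y) ρ (Sum.inr v)).1 u = 0 := by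
    intro u
    have h1 := congrArg (fun F : LinEqMod 2 n => F.1 u) hc
    simp only [lincomb] at h1
    rw [hsplit (fun F => F.1 u)] at h1
    simpa using h1
  have hsnd : ∑ j, c₁ j * (linTest I y ρ j).2 + ∑ v, c₂ v * (pinnedRow (I := I) (y := y) ρ (Sum.inr v)).2 = 1 := by
    have h1 := congrArg Prod.snd hc
    simp only [lincomb] at h1
    rw [hsplit (fun F => F.2)] at h1
    simpa using h1
  -- the pin rows, evaluated
  have hpin1 : ∀ u, ∑ v, c₂ v * (pinnedRow (I := I) (y := y) ρ (Sum.inr v)).1 u = if u ∈ andVars I then c₂ u else 0 := by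
    intro u
    have : ∀ v, c₂ v * (pinnedRow (I := I) (y := y) ρ (Sum.inr v)).1 u =
        if u = v then (if u ∈ andVars I then c₂ u else 0) else 0 := by
      intro v
      by_cases huv : u = v
      · subst huv
        by_cases hu : u ∈ andVars I <;> simp [pinnedRow, hu]
      · by_cases hv : v ∈ andVars I <;> simp [pinnedRow, hv, huv]
    simp only [this, sum_ite_eq, mem_univ, if_true]
  have hpin2 : ∑ v, c₂ v * (pinnedRow (I := I) (y := y) ρ (Sum.inr v)).2 = ∑ v ∈ andVars I, c₂ v * bit (ρ v) := by
    rw [← sum_filter_add_sum_filter_not univ (· ∈ andVars I)]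
    rw [filter_univ_mem, sum_eq_zero (s := univ.filter fun v => v ∉ andVars I), add_zero]
    · refine sum_congr rfl fun v hv => ?_
      simp [pinnedRow, hv]
    · intro v hv
      simp only [mem_filter, mem_univ, true_and] at hv
      simp [pinnedRow, hv]
  -- the row set
  have key : ∀ z : Fin n → Bool, (∀ v ∈ andVars I, z v = ρ v) →
      ∑ j ∈ univ.filter (fun j => c₁ j = 1), disc (linTest I y ρ j) z = 1 := by
    intro z hz
    have hR : ∑ j ∈ univ.filter (fun j => c₁ j = 1), disc (linTest I y ρ j) z = ∑ j, c₁ j * disc (linTest I y ρ j) z := by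
      rw [sum_filter]
      refine sum_congr rfl fun j _ => ?_
      rcases zmod2_eq_zero_or_one (c₁ j) with h | h <;> simp [h]
    rw [hR]
    -- expand the discrepancies
    have hexp : ∑ j, c₁ j * disc (linTest I y ρ j) z =
        ∑ u, bit (z u) * ∑ j, c₁ j * (linTest I y ρ j).1 u + ∑ j, c₁ j * (linTest I y ρ j).2 := by
      simp only [disc, linVal, mul_add, sum_add_distrib, mul_sum]
      congr 1
      rw [sum_comm]
      exact sum_congr rfl fun u _ => sum_congr rfl fun j _ => by ring
    have hP : ∑ u, bit (z u) * ∑ j, c₁ j * (linTest I y ρ j).1 u + ∑ v ∈ andVars I, c₂ v * bit (ρ v) = 0 := by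
      have : ∀ u, bit (z u) * ∑ j, c₁ j * (linTest I y ρ j).1 u =
          bit (z u) * ∑ j, c₁ j * (linTest I y ρ j).1 u + bit (z u) * (if u ∈ andVars I then c₂ u else 0)
            - (if u ∈ andVars I then c₂ u * bit (ρ u) else 0) := by
        intro u
        by_cases hu : u ∈ andVars I
        · simp only [hu, if_true, hz u hu]; ring
        · simp only [hu, if_false]; ring
      rw [sum_congr rfl fun u _ => this u, sum_sub_distrib, ← sum_filter, filter_univ_mem]
      simp only [← mul_add, ← hpin1, hfst, mul_zero, sum_const_zero, zero_sub]
      ring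
    rw [hexp]
    rw [hpin2] at hsnd
    linear_combination hP + hsnd - zmod2_add_self (∑ v ∈ andVars I, c₂ v * bit (ρ v))
  refine ⟨univ.filter fun j => c₁ j = 1, ?_, key⟩
  by_contra hne
  rw [not_nonempty_iff_eq_empty] at hne
  have h1 := key ρ fun v _ => rfl
  rw [hne, sum_empty] at h1
  exact zero_ne_one h1

/-- **T24.2 — the trivial PDT upper bound for pure `P⋆` fibres.**  For a pure `P⋆` instance `I` and a target `y ∉ Range(I)`, some
parity decision tree solves `Search(I, y)` in depth at most `#(andVars I) + ⌈log₂ m⌉`: pin the AND-read positions, then binary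
search along an odd row set of the linearised (infeasible) `𝔽₂` system. -/
theorem exists_solves_depth_le (hI : I.IsPure xorAndPred) (hy : y ∉ I.range) :
    ∃ T : PDT n m, T.Solves I y ∧ T.depth ≤ (andVars I).card + Nat.clog 2 m := by
  obtain ⟨T, hT, hgood⟩ := exists_pdt_query_vars (fun z j => I.eval z j ≠ y j) (andVars I) (Nat.clog 2 m) fun ρ => by
    obtain ⟨R, hRne, hodd⟩ := exists_odd_rows hI hy ρ
    exact exists_pdt_binary_search (fun z j => I.eval z j ≠ y j) (linTest I y ρ) (Nat.clog 2 m) R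
      (fun z => ∀ v ∈ andVars I, z v = ρ v) (fun z hz j _ hd => eval_ne_of_disc_ne_zero hI ρ z hz j hd) hRne
      ((card_le_univ R).trans (by simpa using Nat.le_pow_clog one_lt_two m)) hodd
  exact ⟨T, hgood, hT⟩

/-- The same bound in terms of `m` alone: depth `≤ 2m + ⌈log₂ m⌉` (every output reads two AND positions). -/
theorem exists_solves_depth_le' (hI : I.IsPure xorAndPred) (hy : y ∉ I.range) :
    ∃ T : PDT n m, T.Solves I y ∧ T.depth ≤ 2 * m + Nat.clog 2 m := by
  obtain ⟨T, hT, hd⟩ := exists_solves_depth_le hI hy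
  exact ⟨T, hT, hd.trans (by have := card_andVars_le I; omega)⟩

end Upper

end Summit.PneNP.PneNP.Theorems.PstarPDT
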